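import Literature.IUT.HodgeTheaters.InitialThetaDataTorsionClaimsModelNormaliser
import Literature.IUT.HodgeTheaters.InitialThetaDataTorsionMonodromyUnramified
import HarnessLib

/-!
# [IUTchI] Def 6.1 (v) / §1 p. 37: the monodromy term of the semidirect claims model `regeom₂` is an UNRAMIFIED torsion
# monodromy (abc-iut-L5-t8's v-next datum `UnramifiedTorsionMonodromy`), and the derived local arrow law FIRES there
# (proof-only repackaging, part 6 of the JOINT-NV row)

S. Mochizuki, *Inter-universal Teichmüller theory I*, kurims manuscript (May 2020), §1 p. 37 l. 47–54 «Write `ε̲⁰` for the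
unique “zero cusp” [i.e., “non-nonzero cusp”] of `X̲`; `ε̲′`, `ε̲″` for the two cusps of `X̲` that lie over `ε̲`; and
`Δ_X̲ ↠ Δ^{ab}_X̲ ⊗ (ℤ/lℤ) ↠ Δ_ε̲` for the quotient of `Δ^{ab}_X̲ ⊗ (ℤ/lℤ)` by the images of the inertia groups of all nonzero
cusps `≠ ε̲′, ε̲″` of `X̲`» — so the inertia of `ε̲′`, `ε̲″` SURVIVES in `Δ_ε̲` (l. 55 «`0 → I_{ε̲′} × I_{ε̲″} → Δ_ε̲ → Δ_E̲ ⊗ (ℤ/lℤ)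
→ 0`»), as in this model, whose monodromy term carries the nontrivial inertia line —, §6 Definition 6.1 (v) p. 158 l. 31–32
«arising from the `l`-torsion points of the elliptic curve `E_F̄` [i.e., from the Galois action on `Δ^{ab}_X ⊗ 𝔽_l`]»,
Example 6.3 (i) p. 161 l. 40–47 «for any `t ∈ 𝔽_l ⊆ 𝔽_l^{⋊±}`, let us write `φ^{Θell}_t : 𝒟_t → 𝒟^{⊚±}` for the result of
post-composing `φ^{Θell}_0` with the “poly-action” [i.e., action via poly-automorphisms] of `t` on `𝒟^{⊚±}` [and
pre-composing with the tautological identification of `𝒟_0` with `𝒟_t`]»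
([IUTchI] Def 6.1 (v) p.158) [claim: Mochizuki2012, status: disputed] (D-0012 claim key; series status DISPUTED — theorems
about a MODEL of the cell's `π₁`-interface structures; nothing of the series is asserted; no side taken on [IUTchIII]
Cor. 3.12).  (Doc-only v2: the three quotations re-cut
VERBATIM, with line locators, from the render of record `HOME/lit/renders/IUTchI-kurims-url-690e7b3c6199` (underlines by
`ruleattr.py`) — referee abc-iut-ref-m M20-F6; all declarations byte-identical to p455801.)

## WHAT (proof-only; 0 definitions)

* `nonempty_unramifiedTorsionMonodromy_regeom₂` — abc-iut-L5-t8's `UnramifiedTorsionMonodromy` (p448163: `TorsionMonodromy` +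
  the field `tau_inertia`) is INHABITED at `regeom₂` by `torsionMonodromyRegeom₂` with `tau_inertia := tau_inertia_regeom₂`
  (parts 3/4b) — here with NONTRIVIAL cusp inertia, unlike the degenerate `unramifiedTorsionMonodromyRegeom`;
* `exists_unramifiedTorsionMonodromy_claims_hS` — the joint witness of parts 4b/5 in the reduced binder form
  `{Nonempty UnramifiedTorsionMonodromy, ArrowCoveringClaims, CuspClassesNormaliserStable}` (+ `I_{ε′} ≠ 1`);
* `localArrowLaw_local_regeom₂` — for EVERY cusp-Galois datum `CG` and every `G_v̲ ≤ G_F`, abc-iut-L5-t4's local arrow law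
  `LocalArrowLaw CG hS (Π_{X̲→_K} ∩ augGF⁻¹ G_v̲)` HOLDS at `regeom₂` (abc-iut-L5-d5's derivation p445209/p446471/p446888 as
  re-exported hI-free by abc-iut-L5-t8, fed with the model's `M`, `hA`, `hS`).  HONEST CAVEAT (abc-iut-L5-lead RULINGS #68
  ask (b)): `CuspGalois` needs `l` cusp labels with pairwise non-conjugate decomposition groups and is NOT inhabited at this
  4-label model (`D_{ε⁰} = D_{ε′} = D_{ε″}`), so this last statement is VACUOUS IN `CG` here — it certifies only that no
  further hypothesis on `D` is consumed; the `l`-cusp model is the separate row «JOINT-NV-CG» (abc-iut-L5-t8).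

HONEST LABEL.  Statements about a MODEL «[synthetic rank-1 inertia line, ι-fixed, I_{ε′} = I_{ε″}; finite Δ_X; genuine
Galois action on E_F[l]]»; nothing about the genuine `π₁`; typed ≠ inhabited ≠ discharged; instantiated ≠ endorsed; no
side taken on [IUTchIII] Cor. 3.12.
-/

noncomputable section

namespace Literature.IUT.HodgeTheaters

universe u

namespace InitialThetaData

open TorsionMonodromyModel TorsionClaimsModel
open scoped WeierstrassCurve.Affine Classical

variable {F K Fbar : Type u} [Field F] [NumberField F] [Field K] [NumberField K] [Algebra F K] [Field Fbar]
  [Algebra F Fbar] [Algebra K Fbar] {E : WeierstrassCurve F} [E.IsElliptic] {l : ℕ} {Pb : BadPlacePredicates K}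

/-- **`UnramifiedTorsionMonodromy` is INHABITED at `regeom₂`** (the monodromy term of part 3 with `tau_inertia` = part 4b's
`tau_inertia_regeom₂`, NONTRIVIAL inertia at `ε⁰, ε′, ε″`). [cite: Mochizuki2012, IUTchI Def 6.1 (v) p.158] -/
theorem nonempty_unramifiedTorsionMonodromy_regeom₂ (D₀ : InitialThetaData F K Fbar E l Pb) :
    Nonempty D₀.regeom₂.UnramifiedTorsionMonodromy :=
  ⟨{ D₀.torsionMonodromyRegeom₂ with tau_inertia := D₀.tau_inertia_regeom₂ }⟩

/-- **JOINT witness, reduced binder form**: at ONE initial Θ-datum with the arithmetic of `D₀` — an unramified torsion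
monodromy, the printed §1 claims, the cusp-class law `hS`, and nontrivial cusp inertia.  Tag «[model: synthetic rank-1
inertia line, ι-fixed, I_{ε′} = I_{ε″}; finite Δ_X]»; inhabited ≠ discharged. [cite: Mochizuki2012, IUTchI Def 6.1 (v) p.158] -/
theorem exists_unramifiedTorsionMonodromy_claims_hS (D₀ : InitialThetaData F K Fbar E l Pb) :
    ∃ D : InitialThetaData F K Fbar E l Pb, D.VbadMod = D₀.VbadMod ∧ D.V = D₀.V ∧
      Nonempty D.UnramifiedTorsionMonodromy ∧ D.geom.pe.ArrowCoveringClaims ∧ D.CuspClassesNormaliserStable ∧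
      D.geom.pe.inertia D.geom.pe.ε1 ≠ ⊥ :=
  ⟨D₀.regeom₂, rfl, rfl, D₀.nonempty_unramifiedTorsionMonodromy_regeom₂, D₀.arrowCoveringClaims_regeom₂,
    D₀.cuspClassesNormaliserStable_regeom₂, D₀.inertia_ε1_regeom₂_ne_bot⟩

/-- **The derived local arrow law FIRES at `regeom₂`**: for every cusp-Galois datum `CG` and every `G_v̲ ≤ G_F`, abc-iut-L5-t4's
`LocalArrowLaw CG hS (Π_{X̲→_K} ∩ augGF⁻¹ G_v̲)` holds at `regeom₂` with `hS := cuspClassesNormaliserStable_regeom₂`, by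
abc-iut-L5-d5's derivation (re-exported hI-free by abc-iut-L5-t8 as `UnramifiedTorsionMonodromy.localArrowLaw_local_of_nonempty`)
from the model's own `M`, `hA`, `hS`.  CAVEAT: vacuous in `CG` at this 4-label model (`CuspGalois` is not inhabited here);
no further hypothesis on the datum is consumed. [cite: Mochizuki2012, IUTchI Ex 6.3 (i) p.161] -/
theorem localArrowLaw_local_regeom₂ (D₀ : InitialThetaData F K Fbar E l Pb) [Fact l.Prime]
    (CG : D₀.regeom₂.geom.pe.CuspGalois) (Gv : Subgroup (Fbar ≃ₐ[F] Fbar)) :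
    D₀.regeom₂.LocalArrowLaw CG D₀.cuspClassesNormaliserStable_regeom₂
      (D₀.regeom₂.PiXarrow ⊓ Gv.comap D₀.regeom₂.augGF) :=
  UnramifiedTorsionMonodromy.localArrowLaw_local_of_nonempty CG D₀.cuspClassesNormaliserStable_regeom₂
    D₀.nonempty_unramifiedTorsionMonodromy_regeom₂ D₀.arrowCoveringClaims_regeom₂ Gv

end InitialThetaData

end Literature.IUT.HodgeTheaters

end
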